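import Summits.AtomisticToContinuum.Crystallization.Theorems.FrustratedLawDichotomyStrainedPatchHomEntryLeafHT3
import Summits.AtomisticToContinuum.Crystallization.Theorems.FrustratedLawDichotomyStrainedPatchHomCurvLJAnisoSmoke

/-!
# KERNEL SMOKE (B) of the analytic-slab leaf: the CHUNKED SLOPE certificate at the corner gate cell (`cCorner`, `wGate` = `U 2⁻¹¹ × ξ .00125`)

decomp-a2c hand-1 g29 (crux `AperiodicFrustratedLawGap`, stmt-AtomisticToContinuum-27623; critic rows 1108 (ii)/(iii), 1110 (2)).  KERNEL FINDINGS on the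
slope side of `…HomEntryLeafHT3.entryLeafOKHT3`: (1) the unchunked `slopeCheckLJ` over all 1104 certainly-inside labels dies in one `decide +kernel`
(144 s); (2) the three radius-window chunks pass SEPARATELY (below, 60–90 s each) but their conjunction in ONE `decide` dies too (148 s) — every passing
single `decide` of this lane is `≤ 126 s`, both deaths are at `≈ 145 s`: keep every kernel fact under ≈ 2 min and assemble leaves from per-component
facts by rewriting; (3) chunks must be (near-)complete shells: a lopsided sub-list (`(htNear).take 100`) has `htGs = 0.067·SC` (cancellation lost) versus
`0.0097·SC` for the whole near shell.  Interpreter values at this cell: `htGs near / far₁ / far₂ = 0.009697 / 2.1·10⁻⁵ / 5.9·10⁻⁶ ·SC`, sum `0.009724·SC`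
`≤ pCorner.Gs = 0.009734·SC` (the 1104-label single-list value is `0.009683·SC`: chunking costs `0.4 %`).

* `htSlope_near_corner` — naive guard + `htGs(htNear) ≤ 2729600000000`;
* `htSlope_far1_corner` — `htGs(htFar1) ≤ 5900000000`;
* `htSlope_far2_corner` — `htGs(htFar2) ≤ 1700000000` (396 labels incl. the 33 outside `[−7,7]³`).

Kernel facts only (`decide +kernel`); 0 sorry; standard axioms.  `--supports stmt-AtomisticToContinuum-27623`.
-/


namespace Summit.AtomisticToContinuum.Crystallization.Theorems.FrustratedLawDichotomyStrainedPatchHomEntryLeafHT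

open Literature.Analysis.ValidatedNumerics.Numerics
open Summit.AtomisticToContinuum.Crystallization.Theorems.FrustratedLawDichotomyStrainedPatchHomCurvLJ (cCorner wGate D80 curvCheckLJM)


/-- ★ KERNEL: chunked slope certificate, NEAR chunk (350 labels): naive guard and `htGs ≤ 0.009698·SC` (82 s). -/
theorem htSlope_near_corner :
    (htNaiOK cCorner wGate (htNear cCorner wGate) && decide (htGs cCorner wGate (htNear cCorner wGate) ≤ 2729600000000)) = true := by
  decide +kernel

/-- ★ KERNEL: chunked slope certificate, FAR chunk 1 (`4.7 ≤ ρ < 6`, 358 labels): `htGs ≤ 2.1·10⁻⁵·SC` (83 s). -/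
theorem htSlope_far1_corner :
    (htNaiOK cCorner wGate (htFar1 cCorner wGate) && decide (htGs cCorner wGate (htFar1 cCorner wGate) ≤ 5900000000)) = true := by
  decide +kernel

/-- ★ KERNEL: chunked slope certificate, FAR chunk 2 (`ρ ≥ 6` over `[−11,11]³`, 396 labels): `htGs ≤ 6.1·10⁻⁶·SC`. -/
theorem htSlope_far2_corner :
    (htNaiOK cCorner wGate (htFar2 cCorner wGate) && decide (htGs cCorner wGate (htFar2 cCorner wGate) ≤ 1700000000)) = true := by
  decide +kernel

end Summit.AtomisticToContinuum.Crystallization.Theorems.FrustratedLawDichotomyStrainedPatchHomEntryLeafHT
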